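import Summits.BirchSwinnertonDyer.BirchSwinnertonDyer.Theorems.ResidualThetaTransportAtTwoRlfTwistedShapiroUntwist
import Summits.BirchSwinnertonDyer.BirchSwinnertonDyer.Theorems.ResidualThetaTransportAtTwoRlfTwistLayerRes
import Literature.NumberTheory.GaloisRepresentations.ContinuousShapiroLiftCoresCup
import Literature.NumberTheory.GaloisCohomology.PoitouTateSelmerStructures
import HarnessLib

/-!
# Route `ResidualThetaTransportAtTwo` (RTT P6, item stmt-BirchSwinnertonDyer-23110, road T), H-PLUSDUAL / ISO brick (B4):
# the ASSEMBLY `hiso(u) ⟸ COR-SURJ(J) + LAYER-ISO(J)` — B. D. Kim's descent of the twisted `±`-isotropy at `2` to the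
# layer `U_J` where the twist dies

Width seat `bsd-wall-tp2-p2x-w2` g16 (cell `bsd-wall`), for the LEAD `bsd-wall-tp2-p2x` g12 (registered skeleton `hplusdual` on
23110, stub `stub_iso = ∀ … ∃ B finite ∀ u ∉ B odd, hiso(u)`). HONEST FRAMING: THEOREMS ONLY (no definition, no named fact, no
instance, no `sorry`); `hiso(u)` is proved here ONLY RELATIVE to the two displayed hypotheses COR-SURJ and LAYER-ISO, which are
the targets of the remaining bricks ((C): `…RlfTwistedCoresWitness` + layer-`J` witness classes + `twistedNorm_image_torsionBy_eq`;
θ-plan: dictionary/B_n-extraction + `forall_mem_omegaIdeal_of_compatible` + (d′) + ISO-1abc); closes no item; 23110 is NOT proved;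
BSD is NOT proved by any of this.

The chain (Kim, Compositio 143 (2007), proof of Prop. 4.11 read at `p = 2` for the signed plus condition, twist `χ_u`, level `ℚ_v`):
for `x ∈ L_u`, `y' ∈ L_{u'}` (`u u' ≡ 1 (mod 2^J)`),
`⟨x, H¹(w) y'⟩_v = inv_v(x ∪_{e_tw} y')` (PT-dialect link, B2 `cupProduct_tateDual_map_twistedWeilDual`)
`= inv_v(cor_{U_J}[ψ] ∪_{e_tw} y')` (COR-SURJ: `x = cor [ψ]`, `ψ` a `U_J`-cocycle of `M_u|` with an `A`-witness)
`= inv_v(Sh^{tw}_J[ψ] ∪_{Σ e_tw} Sh^{tw}_J[res y'])` (B1 `cupProduct_cores_eq_cupProduct_shapiroLift`, the projection formula AT THE TOP)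
`= inv_v(Sh_J[ψ₀] ∪_{Σ e} Sh_J[g₀])` (B2 `cupProduct_coindFin_twisted_eq_layerSumPairing`: untwisting on `U_J`, with (R)
`TwistLayer.exists_layer_cocycle_of_mem_twistedTorsionLocalKummer` for `res y'`)
`= inv_v(0) = 0` (LAYER-ISO(J): the untwisted layer classes with `A`-witness are isotropic for the K3 layer pairing
`LayerPairing.layerSumPairing … J` — B. D. Kim Prop. 3.15 at `2`).

* **`iso_of_corSurj_of_layerIso`** — for `E/ℚ`, a `ℤ₂`-extension `κ`, `u` odd:
  COR-SURJ(`u`) ∧ LAYER-ISO ⟹ `hiso(u)` VERBATIM (the binder of `TwistedLocalKummer.plusDualAlt_of_iso` = the inner clause of `stub_iso`).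

References: B. D. Kim, Compositio Math. 143 (2007), Props. 3.15, 3.18, 4.11 [BDKim2007]; J. Neukirch, A. Schmidt, K. Wingberg,
*Cohomology of Number Fields* (2008), I §5 (1.5.3)(iv), I §6 (1.6.4) [NeukirchSchmidtWingberg2008]; J. S. Milne, *Arithmetic
Duality Theorems* (2006), I Cor. 2.3 [MilneADT2006]; S. Kobayashi, Invent. math. 152 (2003), Def. 1.1, (8.23) [Kobayashi2003].
-/

-- the Theorems namespace of this sub repeats the summit name by design (D-0017 nested layout)
set_option linter.dupNamespace false

noncomputable section

open scoped Classical NumberField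
open CategoryTheory Function Field NumberField IsDedekindDomain

namespace Summit.BirchSwinnertonDyer.BirchSwinnertonDyer.Theorems.SignedEC.TwistedLocalKummer

open Literature.NumberTheory.EllipticCurves Literature.NumberTheory.GaloisRepresentations WeierstrassCurve ZpExtension
  Literature.NumberTheory.EllipticCurves.Kobayashi2003 Literature.NumberTheory.GaloisCohomology SignedKatoOffTwo
open Literature.NumberTheory.GaloisRepresentations.DiscreteGaloisModule (localTatePairingZMod)
open scoped ContRepresentation

universe u

/-- **ISO ASSEMBLED modulo COR-SURJ and LAYER-ISO (B. D. Kim's descent to the layer `U_J`).** Let `E/ℚ` be a Weierstrass curve,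
`κ` a `ℤ₂`-extension of `ℚ`, `u` odd, `A = ⋃ₙ E⁺(ℚ_{v,n})`, `L_u = twistedTorsionLocalKummer 2 κ J u hu ℚ_v A`. Assume
* COR-SURJ(`u`): at every `v ∋ 2` and level `J`, every class of `L_u` is the corestriction `cor_{U_J}^{Γ_v}[ψ]` of a continuous
  `U_J`-cocycle `ψ` of `M_u|` (`U_J = LayerPairing.layerGroup κ v J`) having an `A`-WITNESS `(Q, k)` on `N = Gal(ℚ̄_v/ℚ_{v,∞})`
  (`ψ(τ) = τQ − Q` on points, `2^k Q ∈ A`);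
* LAYER-ISO: at every `v ∋ 2`, level `J` and alternating non-degenerate equivariant Weil datum `e` on `E[2^J]`, any two UNTWISTED
  `U_J`-cocycles `f₀, g₀` of `E[2^J]|` with `A`-witnesses pair to zero in the K3 Shapiro currency:
  `Sh_J[f₀] ∪_{Σe} Sh_J[g₀] = 0` (`LayerPairing.layerSumPairing … J`, `LayerPairing.layerShapiro … J`).
Then `hiso(u)`: for all `J`, `u'` with `2^J ∣ u u' − 1`, `e`, perfect `inv`, `v ∋ 2`, `x ∈ L_u`, `y' ∈ L_{u'}`:
`⟨x, H¹(w) y'⟩_v = 0`. [cite: BDKim2007, Prop. 4.11 (proof) and Prop. 3.15] [cite: NeukirchSchmidtWingberg2008, I §5 (1.5.3)(iv)]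
[cite: MilneADT2006, Ch. I Cor. 2.3] -/
theorem iso_of_corSurj_of_layerIso (E : WeierstrassCurve ℚ) [E.IsElliptic] (κ : ZpExtension ℚ 2) (u : ℤ) (hu : (2 : ℤ) ∣ u - 1)
    (hCor : ∀ (J : ℕ) (v : HeightOneSpectrum (𝓞 ℚ)) [Fintype (absoluteGaloisGroup (v.adicCompletion ℚ) ⧸ LayerPairing.layerGroup κ v J)],
      ((2 : ℕ) : 𝓞 ℚ) ∈ v.asIdeal →
      ∀ x ∈ E.twistedTorsionLocalKummer 2 κ J u hu (v.adicCompletion ℚ) (⨆ n : ℕ, signedLocalPoints κ (v.adicCompletion ℚ) E 1 n),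
        ∃ (ψ : contOneCocycles (subgroupRep ((E.twistedTorsionGaloisModule 2 κ J u hu).restrictField (v.adicCompletion ℚ)).toTopRep
            (LayerPairing.layerGroup κ v J))) (Q : localPoints E (v.adicCompletion ℚ)) (k : ℕ),
          cores ((E.twistedTorsionGaloisModule 2 κ J u hu).restrictField (v.adicCompletion ℚ)).toTopRep (LayerPairing.layerGroup κ v J)
              (LayerPairing.isOpen_layerGroup κ v J) (oneCocycleClass _ ψ) = x ∧
          2 ^ k • Q ∈ (⨆ n : ℕ, signedLocalPoints κ (v.adicCompletion ℚ) E 1 n) ∧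
          ∀ (τ : absoluteGaloisGroup (v.adicCompletion ℚ)) (hτ : τ ∈ localSubgroup κ.kerSubgroup (v.adicCompletion ℚ)),
            pointsMap E (v.adicCompletion ℚ) ((ψ.1 ⟨τ, kerLocal_le_layerGroup κ v J hτ⟩ : E.geomTorsion ((2 ^ J : ℕ) : ℤ)) :
              E.geomPoints) = τ • Q - Q)
    (hLI : ∀ (J : ℕ) (e : E.geomTorsion ((2 ^ J : ℕ) : ℤ) → E.geomTorsion ((2 ^ J : ℕ) : ℤ) → AlgebraicClosure ℚ)
      (hμ : ∀ S T, e S T ^ (2 ^ J) = 1) (hadd₁ : ∀ S₁ S₂ T, e (S₁ + S₂) T = e S₁ T * e S₂ T)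
      (hadd₂ : ∀ S T₁ T₂, e S (T₁ + T₂) = e S T₁ * e S T₂)
      (hgal : ∀ (σ : absoluteGaloisGroup ℚ) (S T : E.geomTorsion ((2 ^ J : ℕ) : ℤ)), σ • e S T = e (σ • S) (σ • T)),
      (∀ T, e T T = 1) → (∀ T, (∀ S, e S T = 1) → T = 0) → ∀ [NeZero (2 ^ J)],
      ∀ (v : HeightOneSpectrum (𝓞 ℚ)) [CompactSpace (absoluteGaloisGroup (v.adicCompletion ℚ))], ((2 : ℕ) : 𝓞 ℚ) ∈ v.asIdeal →
      ∀ (f₀ g₀ : contOneCocycles (subgroupRep (LayerPairing.torsionLocalRep E (2 ^ J) v) (LayerPairing.layerGroup κ v J)))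
        (Qf Qg : localPoints E (v.adicCompletion ℚ)) (kf kg : ℕ),
        2 ^ kf • Qf ∈ (⨆ n : ℕ, signedLocalPoints κ (v.adicCompletion ℚ) E 1 n) →
        (∀ (τ : absoluteGaloisGroup (v.adicCompletion ℚ)) (hτ : τ ∈ localSubgroup κ.kerSubgroup (v.adicCompletion ℚ)),
          pointsMap E (v.adicCompletion ℚ) ((f₀.1 ⟨τ, kerLocal_le_layerGroup κ v J hτ⟩ : E.geomTorsion ((2 ^ J : ℕ) : ℤ)) :
            E.geomPoints) = τ • Qf - Qf) →
        2 ^ kg • Qg ∈ (⨆ n : ℕ, signedLocalPoints κ (v.adicCompletion ℚ) E 1 n) →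
        (∀ (τ : absoluteGaloisGroup (v.adicCompletion ℚ)) (hτ : τ ∈ localSubgroup κ.kerSubgroup (v.adicCompletion ℚ)),
          pointsMap E (v.adicCompletion ℚ) ((g₀.1 ⟨τ, kerLocal_le_layerGroup κ v J hτ⟩ : E.geomTorsion ((2 ^ J : ℕ) : ℤ)) :
            E.geomPoints) = τ • Qg - Qg) →
        (LayerPairing.layerSumPairing E (2 ^ J) e hμ hadd₁ hadd₂ hgal κ v J).cupProduct
          (LayerPairing.layerShapiro E (2 ^ J) κ v J (oneCocycleClass _ f₀))
          (LayerPairing.layerShapiro E (2 ^ J) κ v J (oneCocycleClass _ g₀)) = 0) :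
    ∀ (J : ℕ) (u' : ℤ) (hu' : (2 : ℤ) ∣ u' - 1) (huu' : ((2 : ℤ) ^ J) ∣ u * u' - 1)
      (e : E.geomTorsion ((2 ^ J : ℕ) : ℤ) → E.geomTorsion ((2 ^ J : ℕ) : ℤ) → AlgebraicClosure ℚ)
      (hμ : ∀ S T, e S T ^ (2 ^ J) = 1) (hadd₁ : ∀ S₁ S₂ T, e (S₁ + S₂) T = e S₁ T * e S₂ T)
      (hadd₂ : ∀ S T₁ T₂, e S (T₁ + T₂) = e S T₁ * e S T₂)
      (hgal : ∀ (σ : absoluteGaloisGroup ℚ) (S T : E.geomTorsion ((2 ^ J : ℕ) : ℤ)), σ • e S T = e (σ • S) (σ • T))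
      (_halt : ∀ T, e T T = 1) (_hnondeg : ∀ T, (∀ S, e S T = 1) → T = 0)
      [Finite (E.geomTorsion ((2 ^ J : ℕ) : ℤ))]
      (inv : LocalInvariants ℚ (2 ^ J)), inv.IsPerfect →
      ∀ (v : HeightOneSpectrum (𝓞 ℚ)), ((2 : ℕ) : 𝓞 ℚ) ∈ v.asIdeal →
      ∀ x ∈ E.twistedTorsionLocalKummer 2 κ J u hu (v.adicCompletion ℚ) (⨆ n : ℕ, signedLocalPoints κ (v.adicCompletion ℚ) E 1 n),
      ∀ y' ∈ E.twistedTorsionLocalKummer 2 κ J u' hu' (v.adicCompletion ℚ) (⨆ n : ℕ, signedLocalPoints κ (v.adicCompletion ℚ) E 1 n),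
        localTatePairingZMod (E.twistedTorsionGaloisModule 2 κ J u hu) (2 ^ J) (Sum.inr v) (inv (Sum.inr v)) x
          (galoisCohomology.map ((E.twistedWeilDual 2 κ J hu hu' huu' e hμ hadd₁ hadd₂ hgal).restrictField (v.adicCompletion ℚ)) 1
            y') = 0 := by
  intro J u' hu' huu' e hμ hadd₁ hadd₂ hgal halt hnondeg _ inv _ v hv x hx y' hy'
  haveI : Fact (Nat.Prime 2) := ⟨Nat.prime_two⟩
  haveI : NeZero (2 ^ J) := ⟨pow_ne_zero _ two_ne_zero⟩
  haveI : CompactSpace (absoluteGaloisGroup (v.adicCompletion ℚ)) := absoluteGaloisGroup_compactSpace _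
  letI : Fintype (absoluteGaloisGroup (v.adicCompletion ℚ) ⧸ LayerPairing.layerGroup κ v J) := LayerPairing.layerFintypeQuot κ v J
  have huu'' : ((2 : ℤ) ^ J) ∣ u' * u - 1 := by rwa [mul_comm] at huu'
  -- (6) the PT-dialect link: `⟨x, H¹(w) y'⟩_v = inv_v (x ∪_{e_tw} y')`
  obtain ⟨P, hP⟩ := exists_twistedWeilLocalPairing E κ J hu hu' huu' v e hμ hadd₁ hadd₂ hgal
  rw [DiscreteGaloisModule.localTatePairingZMod_apply,
    cupProduct_tateDual_map_twistedWeilDual E κ J hu hu' huu' v e hμ hadd₁ hadd₂ hgal P hP x y']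
  -- COR-SURJ: `x = cor_{U_J} [ψ]`
  obtain ⟨ψ, Q, k, hcor, hkQ, hψ⟩ := hCor J v hv x hx
  subst hcor
  -- (B1) the projection formula at the top
  rw [cupProduct_cores_eq_cupProduct_shapiroLift P (LayerPairing.layerGroup κ v J) (LayerPairing.isOpen_layerGroup κ v J)
    (LayerPairing.layerReps_spec κ v J) (LayerPairing.layerReps_one κ v J)]
  -- (R): the restriction of `y'` to `U_J`, as a twisted and as an untwisted layer cocycle with the same witness
  obtain ⟨ξ, g₀, Qg, kg, hξ, hg₀, hkQg, hg₀wit⟩ :=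
    TwistLayer.exists_layer_cocycle_of_mem_twistedTorsionLocalKummer κ v E (le_refl J) u' hu' _ hy'
  subst hξ
  rw [resSubgroup_oneCocycleClass]
  -- untwisting (B2)
  obtain ⟨ψ₀, hψ₀⟩ := exists_untwist_layerCocycle E κ J u hu v ψ
  obtain ⟨Ψ, hΨ⟩ := exists_coindFin_untwist E κ J hu hu' huu' v
  obtain ⟨Ψ', hΨ'⟩ := exists_coindFin_untwist E κ J hu' hu huu'' v
  rw [cupProduct_coindFin_twisted_eq_layerSumPairing E κ J hu hu' huu' v e hμ hadd₁ hadd₂ hgal P hP Ψ hΨ Ψ' hΨ' ψ _ ψ₀ g₀ hψ₀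
    (fun τ ↦ hg₀ τ)]
  -- LAYER-ISO(J)
  have hψ₀wit : ∀ (τ : absoluteGaloisGroup (v.adicCompletion ℚ)) (hτ : τ ∈ localSubgroup κ.kerSubgroup (v.adicCompletion ℚ)),
      pointsMap E (v.adicCompletion ℚ) ((ψ₀.1 ⟨τ, kerLocal_le_layerGroup κ v J hτ⟩ : E.geomTorsion ((2 ^ J : ℕ) : ℤ)) :
        E.geomPoints) = τ • Q - Q := fun τ hτ ↦ by rw [hψ₀]; exact hψ τ hτ
  have h0 := hLI J e hμ hadd₁ hadd₂ hgal halt hnondeg v hv ψ₀ g₀ Q Qg k kg hkQ hψ₀wit hkQg (fun τ hτ ↦ hg₀wit ⟨τ, hτ⟩)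
  have h1 : ((LayerPairing.weilLocalPairing E (2 ^ J) e hμ hadd₁ hadd₂ hgal v).coindFin (LayerPairing.layerGroup κ v J)).cupProduct
        (LayerPairing.layerShapiro E (2 ^ J) κ v J (oneCocycleClass _ ψ₀))
        (LayerPairing.layerShapiro E (2 ^ J) κ v J (oneCocycleClass _ g₀)) =
      (LayerPairing.layerSumPairing E (2 ^ J) e hμ hadd₁ hadd₂ hgal κ v J).cupProduct
        (LayerPairing.layerShapiro E (2 ^ J) κ v J (oneCocycleClass _ ψ₀))
        (LayerPairing.layerShapiro E (2 ^ J) κ v J (oneCocycleClass _ g₀)) := rfl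
  rw [h1, h0]
  exact (inv (Sum.inr v)).map_zero

end Summit.BirchSwinnertonDyer.BirchSwinnertonDyer.Theorems.SignedEC.TwistedLocalKummer

end
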